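import Summits.ResolutionOfSingularities.ResolutionOfSingularities.Theorems.HilbertSamuelEliminationSigmaMaxModificationsCorridor3WLadderSegmentsCut
import Summits.ResolutionOfSingularities.ResolutionOfSingularities.Theorems.HilbertSamuelEliminationSigmaMaxModificationsCorridor3WLadderUnitStart
import Summits.ResolutionOfSingularities.ResolutionOfSingularities.Theorems.HilbertSamuelEliminationSigmaMaxModificationsCorridor3ChainTowerOrigin
import Summits.ResolutionOfSingularities.ResolutionOfSingularities.Theorems.HilbertSamuelEliminationCampaignW42TertiaryReduction
import Literature.AlgebraicGeometry.CossartJannsenSaito2020.BlowupTowerLocalizePerm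
import Literature.AlgebraicGeometry.CossartJannsenSaito2020.BlowupTowerLocalizeTransfer
import Literature.AlgebraicGeometry.CossartJannsenSaito2020.KeyTheoremsLocal
import HarnessLib

/-!
# [OURS · L1 W4.2] THE UNIT TOWERS OF A CHAIN: the localised, compressed tower of each segment and its generic data
# (crux `SigmaMaxModifications` stmt-ResolutionOfSingularities-18506; conjunct `SigmaMaxModificationsCorridor3` stmt-…-19249; line
# `w_ladder` v6; plan-1 RULINGS v3.10-1 (A) «U-seg = segment extraction», object `Moving.UnitTowerExtractionLocAtQM`)

Stub worker res-L1-w42-stub-1 (gen 3). Helper file `--supports stmt-ResolutionOfSingularities-19249 --as helper`; kernel only, no named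
fact. For a chain `c` of canonical near steps (admissible oracle, `ν ≠ Φ^{(N)}`, cycle invariant at `c 0`) and a base stage `b`:

* `upTower b` — lead-1's blow-up tower of the chain SHIFTED to `b` (`n ↦ c (b + n)`, `Helpers.chainTowerOfCycleInv`); `locTower b` — its
  localisation at the marked point `x_b` (res-type-053's `BlowupTower.localize`: base change along `Spec 𝒪_{X_b,x_b} → X_b`, CJS p. 107);
* `HEmp b` — the hypothesis «a WAITING step's centre misses the local scheme at `x_b`» (the localised centre of a non-blown-up stage
  is EMPTY); under it, `unitTower b` — `locTower b` COMPRESSED along the stages that are not blown up (`BlowupTower.compress` of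
  `…WLadderTowerCompress` with the gap function `Seg.relGap` of `…WLadderSegmentsCut`: its stages are exactly the blown-up stages
  `b = g_0 < g_1 < ⋯` of the chain from `b`), of length `unitLen b = Seg.relLen` (the first later blown-up stage whose marked point is
  isolated in its Hilbert–Samuel locus), with initial point `basePt b = 𝔪_{x_b}` and terminal point `termPt b` = THE point of the
  localised terminal stage over `x_{b'}`, `b' = Seg.nextBase b`;
* the GENERIC DATA of CJS Def. 6.38 for `unitTower b` — everything except the centre discipline (ii)′ `C_1 = ℙ(Dir)`, (iii)
  `C_q = near locus`, (iv) `C_{q} ⥲ C_{q-1}`, (v) non-surjectivity: the initial stage is the local scheme `Spec 𝒪_{X_b,x_b}`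
  (`isLocalAt_unitTower`), `KeySetting` transfers (`keySetting_unitTower`), the centres are permissible (`isPermissible_centreIdeal_unitTower`,
  053's (m3) + lead-1's permissibility), `C_0 = {𝔪_{x_b}}` when `b` is blown up at a marked point isolated in its Hilbert–Samuel locus
  (`unitTower_C_zero`, from `…WLadderUnitStart`), `e`/`ē`/`H` at the initial and terminal points are those of the chain
  (`dirDimAt_unitTower_zero`, `…_terminal`, `hsFun_unitTower_terminal`), the terminal point is closed and lies over the initial point, and
  THE LINK of Def. 6.39 read locally: `Spec 𝒪_{X_{b'},x_{b'}}` is the local scheme of the terminal stage at the terminal point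
  (`isLocalSchemeAt_unitTower_terminal`, Spec of 053's `isIso_stalkMap_bcι`); isolation of `𝔪_{x_b}` in the Hilbert–Samuel locus of
  `Spec 𝒪_{X_b,x_b}` from isolation of `x_b` in its `ν`-stratum (`isIsolatedInHSMaxLocus_localize_of_stratumIsolated`, given upper
  semicontinuity of `H` along generizations at `x_b`).

OURS bookkeeping; NOT a statement of the manuscript [Hironaka2017] nor of [CossartJannsenSaito2020]. AI-written; AI review is weaker than
expert review.

References: V. Cossart, U. Jannsen, S. Saito, LNM 2270 (2020), Def. 6.38, Def. 6.39, p. 107, Def. 13.3 [CossartJannsenSaito2020].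
-/

noncomputable section

set_option linter.dupNamespace false -- namespace `…Corridor3.Moving` re-enters `…Corridor3` (module convention of the Moving files)

open CategoryTheory AlgebraicGeometry TopologicalSpace Topology IsLocalRing
open Literature.AlgebraicGeometry.Resolution Literature.RingTheory.HilbertSamuel
open Literature.AlgebraicGeometry.CossartJannsenSaito2020
open Summit.ResolutionOfSingularities.ResolutionOfSingularities.Theorems.CampaignW42
open Summit.ResolutionOfSingularities.ResolutionOfSingularities.Theorems.SigmaMaxModificationsCorridor3.Helpers

namespace Summit.ResolutionOfSingularities.ResolutionOfSingularities.Theorems.SigmaMaxModificationsCorridor3.Moving.Seg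

universe u

variable {R : ∀ S : Scheme.{u}, CentreSeq S → Prop} {N : ℕ} {ν : ℕ → ℕ} {k : Type u} [Field k]

/-! ## §0. Isolation in the Hilbert–Samuel locus of the local scheme from isolation in the stratum -/

/-- **«`x` isolated in its `ν`-STRATUM» ⇒ «`𝔪_x` isolated in the Hilbert–Samuel locus of `Spec 𝒪_{X,x}`»**, given upper semicontinuity
of `H_X` along generizations at `x` (CJS Thm. 2.33 (1)): every point of the local scheme generizes `x`, so `H ≤ H(x)` there and
`H(𝔪_x) = H_X(x)` is the maximum; a point of the Hilbert–Samuel locus of the local scheme in the preimage of `U` then maps to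
`U ∩ X(ν) ⊆ {x}`. (Variant of res-type-053's `isIsolatedInHSMaxLocus_localize`, which starts from isolation in `X_max` upstairs.)
[cite: CossartJannsenSaito2020, Def. 13.3, Thm. 2.33 (1), p. 107] -/
theorem isIsolatedInHSMaxLocus_localize_of_stratumIsolated (T : BlowupTower.{u}) (x : T.X 0) (N : ℕ)
    (hsc : ∀ y : T.X 0, y ⤳ x → Scheme.hsFun (T.X 0) N y ≤ Scheme.hsFun (T.X 0) N x)
    (hU : ∃ U : Set (T.X 0), IsOpen U ∧ x ∈ U ∧ U ∩ Scheme.hsStratum (T.X 0) N (Scheme.hsFun (T.X 0) N x) ⊆ {x}) :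
    @IsIsolatedInHSMaxLocus ((T.localize x).X 0) ((T.localize x).ln 0) N (closedPoint ((T.X 0).presheaf.stalk x)) := by
  haveI : IsLocallyNoetherian (T.X 0) := T.ln 0
  haveI : IsLocallyNoetherian ((T.localize x).X 0) := (T.localize x).ln 0
  obtain ⟨U, hUo, hxU, hUiso⟩ := hU
  set ι := (T.X 0).fromSpecStalk x with hι
  have hιc : ι.base (closedPoint ((T.X 0).presheaf.stalk x)) = x := Scheme.fromSpecStalk_closedPoint
  have hH : ∀ s, Scheme.hsFun ((T.localize x).X 0) N s = Scheme.hsFun (T.X 0) N (ι.base s) :=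
    fun s => Scheme.hsFun_fromSpecStalk (T.X 0) x N s
  have hgen : ∀ s, ι.base s ⤳ x := fun s => by
    have hs : ι.base s ∈ Set.range ι.base := ⟨s, rfl⟩
    rw [hι, Scheme.range_fromSpecStalk] at hs
    exact hs
  -- `H(s) ≤ H(𝔪)` on the local scheme
  have hle : ∀ s, Scheme.hsFun ((T.localize x).X 0) N s ≤
      Scheme.hsFun ((T.localize x).X 0) N (closedPoint ((T.X 0).presheaf.stalk x)) := fun s => by
    rw [hH, hH, hιc]; exact hsc _ (hgen s)
  refine ⟨ι.base ⁻¹' U, hUo.preimage ι.continuous, ?_⟩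
  ext s
  simp only [Set.mem_inter_iff, Set.mem_preimage, Set.mem_singleton_iff]
  constructor
  · rintro ⟨hsU, hsmax⟩
    have heq : Scheme.hsFun ((T.localize x).X 0) N s =
        Scheme.hsFun ((T.localize x).X 0) N (closedPoint ((T.X 0).presheaf.stalk x)) :=
      le_antisymm (hle s) ((Scheme.mem_hsMaxLocus_iff.mp hsmax).2 ⟨_, rfl⟩ (hle s))
    have hιs : ι.base s ∈ U ∩ Scheme.hsStratum (T.X 0) N (Scheme.hsFun (T.X 0) N x) := by
      refine ⟨hsU, Scheme.mem_hsStratum_iff.mpr ?_⟩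
      have h := heq
      rw [hH, hH, hιc] at h
      exact h
    have h1 : ι.base s = x := hUiso hιs
    exact ι.isEmbedding.injective (h1.trans hιc.symm)
  · rintro rfl
    refine ⟨by rw [hιc]; exact hxU, Scheme.mem_hsMaxLocus_iff.mpr ⟨⟨_, rfl⟩, ?_⟩⟩
    rintro μ ⟨t, rfl⟩ hμ
    exact (le_antisymm (hle t) hμ).le

/-! ## §1. The shifted chain, its tower, the localised tower -/

section Chain

variable {c : ℕ → MarkedStage.{u}}

/-- The steps of the chain shifted to the base `b`. [folklore] -/
theorem shiftStep (hc : ∀ n, CanonicalNearStep R N ν (c n) (c (n + 1))) (b : ℕ) :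
    ∀ n, CanonicalNearStep R N ν (c (b + n)) (c (b + (n + 1))) := fun n => hc (b + n)

/-- `c (b + n)` is reached from `c b`. [folklore] -/
theorem reaches_add (hc : ∀ n, CanonicalNearStep R N ν (c n) (c (n + 1))) (b : ℕ) : ∀ n, Reaches R N ν (c b) (c (b + n))
  | 0 => Relation.ReflTransGen.refl
  | n + 1 => (reaches_add hc b n).tail (hc (b + n))

/-- The cycle invariant at every stage of the chain. [folklore] -/
theorem cycleInv_at (hc : ∀ n, CanonicalNearStep R N ν (c n) (c (n + 1))) (hRa : OracleAdmissible R) (hν : ν ≠ iterPSum N Phi)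
    (h0 : Helpers.CycleInv k N ν (c 0)) (b : ℕ) : Helpers.CycleInv k N ν (c b) :=
  Helpers.CycleInv.of_reaches hRa hν h0 (by simpa using reaches_add hc 0 b)

/-- [OURS] The blow-up tower of the chain SHIFTED to the base `b` (lead-1's `Helpers.chainTowerOfCycleInv` of `n ↦ c (b + n)`): stages
`X_{b+n}`, centres the canonical centres, projections the step projections. [cite: CossartJannsenSaito2020, Def. 6.34] -/
def upTower (hc : ∀ n, CanonicalNearStep R N ν (c n) (c (n + 1))) (hRa : OracleAdmissible R) (hν : ν ≠ iterPSum N Phi)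
    (h0 : Helpers.CycleInv k N ν (c 0)) (b : ℕ) : BlowupTower.{u} :=
  Helpers.chainTowerOfCycleInv (c := fun n => c (b + n)) (shiftStep hc b) hRa hν (cycleInv_at hc hRa hν h0 b)

variable (hc : ∀ n, CanonicalNearStep R N ν (c n) (c (n + 1))) (hRa : OracleAdmissible R) (hν : ν ≠ iterPSum N Phi)
  (h0 : Helpers.CycleInv k N ν (c 0))

include hRa hν h0 in
/-- The chain's centres from the base are radical (lead-1), the datum `hrad` of `Helpers.chainTower`. [folklore] -/
theorem upTower_hrad (b : ℕ) : ∀ n, Helpers.chainCentre (shiftStep hc b) n =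
    Scheme.IdealSheafData.vanishingIdeal (Helpers.chainCentre (shiftStep hc b) n).support :=
  Helpers.chainCentre_eq_vanishingIdeal_support (shiftStep hc b) hRa hν (cycleInv_at hc hRa hν h0 b)

/-- `upTower b` IS lead-1's `chainTower` of the shifted chain. [folklore] -/
theorem upTower_eq (b : ℕ) : upTower hc hRa hν h0 b = Helpers.chainTower (shiftStep hc b) (upTower_hrad hc hRa hν h0 b) := rfl

/-- Unfolding: the stages of `upTower b` are the `X_{b+n}`. [folklore] -/
theorem upTower_X (b n : ℕ) : (upTower hc hRa hν h0 b).X n = (c (b + n)).W := rfl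

/-- Unfolding: the centres of `upTower b` are the supports of the chain's canonical centres. [folklore] -/
theorem upTower_C (b n : ℕ) :
    (upTower hc hRa hν h0 b).C n = ((Helpers.chainCentre (shiftStep hc b) n).support : Set (c (b + n)).W) := rfl

/-- The marked points lie over the base marked point: `φ_n(x_{b+n}) = x_b`. [cite: CossartJannsenSaito2020, Def. 6.34 (ii)] -/
theorem upTower_phi_pt (b n : ℕ) : ((upTower hc hRa hν h0 b).phi n).base (c (b + n)).pt = (c b).pt :=
  Helpers.phi_chainTower_base_pt (shiftStep hc b) (upTower_hrad hc hRa hν h0 b) n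

/-- GENUINE ⇔ the marked point lies in the tower's centre (functional oracle). [cite: CossartJannsenSaito2020, Rem. 6.29 (1)] -/
theorem pt_mem_upTower_C_iff (hRf : OracleFunctional R) (b n : ℕ) :
    (c (b + n)).pt ∈ (upTower hc hRa hν h0 b).C n ↔ (c (b + n)).IsBlownUp R N ν :=
  Helpers.pt_mem_chainTower_C_iff (shiftStep hc b) (upTower_hrad hc hRa hν h0 b) hRf n

/-- The centres of `upTower b` are permissible. [cite: CossartJannsenSaito2020, Lemma 5.34 (3), Thm. 3.3] -/
theorem isPermissible_centreIdeal_upTower (b n : ℕ) : IdealSheafData.IsPermissible ((upTower hc hRa hν h0 b).centreIdeal n) :=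
  Helpers.isPermissible_centreIdeal_chainTowerOfCycleInv (shiftStep hc b) hRa hν _ n

/-- `KeySetting (upTower b) N`. [cite: CossartJannsenSaito2020, Thm. 6.28 (setting)] -/
theorem keySetting_upTower (b : ℕ) : KeySetting (upTower hc hRa hν h0 b) N :=
  Helpers.keySetting_chainTowerOfCycleInv (shiftStep hc b) hRa hν _

/-- [OURS] THE LOCALISED TOWER AT THE BASE: `upTower b ×_{X_b} Spec 𝒪_{X_b,x_b}` (res-type-053's `BlowupTower.localize`, CJS p. 107).
[cite: CossartJannsenSaito2020, p. 107] -/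
def locTower (b : ℕ) : BlowupTower.{u} :=
  (upTower hc hRa hν h0 b).localize ((c b).pt : (upTower hc hRa hν h0 b).X 0)

/-- Unfolding. [folklore] -/
theorem locTower_eq (b : ℕ) :
    locTower hc hRa hν h0 b = (upTower hc hRa hν h0 b).localize ((c b).pt : (upTower hc hRa hν h0 b).X 0) :=
  rfl

/-- The localised tower starts on `Spec 𝒪_{X_b,x_b}`. [cite: CossartJannsenSaito2020, p. 107] -/
theorem locTower_X_zero (b : ℕ) : (locTower hc hRa hν h0 b).X 0 = Spec ((c b).W.presheaf.stalk (c b).pt) := rfl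

end Chain

/-! ## §2. The unit tower of the segment based at `b` -/

section Unit

variable {c : ℕ → MarkedStage.{u}} (hc : ∀ n, CanonicalNearStep R N ν (c n) (c (n + 1))) (hRa : OracleAdmissible R)
  (hν : ν ≠ iterPSum N Phi) (h0 : Helpers.CycleInv k N ν (c 0)) (hgen : ∀ n, ∃ m, n ≤ m ∧ (c m).IsBlownUp R N ν)
  (hBG : ∀ n, ∃ m, n ≤ m ∧ (c m).IsBlownUp R N ν ∧ Iso N (c m))

/-- [OURS] The comparison maps `ι_n` of the localised tower at the base `b` (`Spec 𝒪 ×_{X_b} X_{b+n} ⟶ X_{b+n}`). [folklore] -/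
abbrev locι (b n : ℕ) : (locTower hc hRa hν h0 b).X n ⟶ (upTower hc hRa hν h0 b).X n :=
  (upTower hc hRa hν h0 b).bcι (((upTower hc hRa hν h0 b).X 0).fromSpecStalk ((c b).pt : (upTower hc hRa hν h0 b).X 0)) n

/-- [OURS] **(H-emp) AT THE BASE `b`**: the localised centre of every stage of the chain from `b` that is NOT blown up at its marked point is
EMPTY («a waiting step's centre misses the local scheme at `x_b`»; label discipline + near-point analysis — the recognition side).
[cite: CossartJannsenSaito2020, Def. 6.38 (iii), Rem. 6.29 (1)] -/
def HEmp (b : ℕ) : Prop :=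
  ∀ n, ¬ (c (b + n)).IsBlownUp R N ν → (locTower hc hRa hν h0 b).C n = ∅

/-- Under (H-emp), the stages skipped by the gap function `Seg.relGap` have empty localised centres (the hypothesis `htriv` of
`BlowupTower.compress`). [folklore] -/
theorem htriv_of_hEmp {b : ℕ} (hemp : HEmp hc hRa hν h0 b) :
    ∀ q j, j < Seg.relGap hgen b q → (locTower hc hRa hν h0 b).C (BlowupTower.cidx 0 (Seg.relGap hgen b) q + j + 1) = ∅ :=
  fun q _ hj => hemp _ (Seg.not_B_add_relIdx_add hgen b (k := q) hj)

/-- [OURS] **THE UNIT TOWER BASED AT `b`**: the localised tower at `x_b` COMPRESSED along the stages not blown up at their marked points —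
its stages are the blown-up stages `b = g_0 < g_1 < ⋯` of the chain read on the local scheme at `x_b` (CJS Def. 6.38 lists only these).
[cite: CossartJannsenSaito2020, Def. 6.38, p. 107] -/
def unitTower (b : ℕ) (hemp : HEmp hc hRa hν h0 b) : BlowupTower.{u} :=
  (locTower hc hRa hν h0 b).compress 0 (Seg.relGap hgen b) (htriv_of_hEmp hc hRa hν h0 hgen hemp)

/-- [OURS] THE LENGTH of the unit based at `b` (`Seg.relLen`: the first later blown-up stage whose marked point is isolated in its
Hilbert–Samuel locus). [cite: CossartJannsenSaito2020, Def. 6.38] -/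
abbrev unitLen (b : ℕ) : ℕ :=
  Seg.relLen hgen hBG b

/-- [OURS] The relative index of the terminal stage: `b + termIdx b = Seg.nextBase b`. [folklore] -/
abbrev termIdx (b : ℕ) : ℕ :=
  Seg.relIdx hgen b (unitLen hgen hBG b)

/-- [OURS] THE INITIAL POINT of the unit based at `b`: the closed point `𝔪_{x_b}` of `Spec 𝒪_{X_b,x_b}`. [cite: CossartJannsenSaito2020, Def. 6.38 (i)] -/
def basePt (b : ℕ) : (locTower hc hRa hν h0 b).X 0 :=
  closedPoint ((c b).W.presheaf.stalk (c b).pt)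

/-- THE terminal marked point `x_{b'}`, `b' = nextBase b`, is reached by the localised tower at `x_b`. [cite: CossartJannsenSaito2020, p. 107] -/
theorem exists_termPt (b : ℕ) : ∃ y : (locTower hc hRa hν h0 b).X (termIdx hgen hBG b),
    (locι hc hRa hν h0 b (termIdx hgen hBG b)).base y = (c (b + termIdx hgen hBG b)).pt :=
  (upTower hc hRa hν h0 b).mem_range_bcι_localize_of_phi_eq (c b).pt _ _ (upTower_phi_pt hc hRa hν h0 b _)

/-- [OURS] THE TERMINAL POINT of the unit based at `b`: the point of the localised terminal stage over `x_{b'}`.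
[cite: CossartJannsenSaito2020, Def. 6.38 (vi)] -/
def termPt (b : ℕ) (hemp : HEmp hc hRa hν h0 b) : (unitTower hc hRa hν h0 hgen b hemp).X (unitLen hgen hBG b) :=
  Classical.choose (exists_termPt hc hRa hν h0 hgen hBG b)

/-- The terminal point lies over `x_{b'}`, `b' = Seg.nextBase b`. [cite: CossartJannsenSaito2020, Def. 6.38 (vi)] -/
theorem locι_termPt (b : ℕ) (hemp : HEmp hc hRa hν h0 b) :
    (locι hc hRa hν h0 b (termIdx hgen hBG b)).base (termPt hc hRa hν h0 hgen hBG b hemp) = (c (Seg.nextBase hgen hBG b)).pt :=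
  Classical.choose_spec (exists_termPt hc hRa hν h0 hgen hBG b)

/-! ### Unfoldings -/

/-- The initial stage of the unit tower is `Spec 𝒪_{X_b,x_b}`. [cite: CossartJannsenSaito2020, p. 107] -/
theorem unitTower_X_zero (b : ℕ) (hemp : HEmp hc hRa hν h0 b) :
    (unitTower hc hRa hν h0 hgen b hemp).X 0 = Spec ((c b).W.presheaf.stalk (c b).pt) := rfl

/-- The stages of the unit tower are the localised blown-up stages. [folklore] -/
theorem unitTower_X (b : ℕ) (hemp : HEmp hc hRa hν h0 b) (q : ℕ) :
    (unitTower hc hRa hν h0 hgen b hemp).X q = (locTower hc hRa hν h0 b).X (Seg.relIdx hgen b q) := rfl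

/-- The centres of the unit tower are the localised centres of the blown-up stages. [folklore] -/
theorem unitTower_C (b : ℕ) (hemp : HEmp hc hRa hν h0 b) (q : ℕ) :
    (unitTower hc hRa hν h0 hgen b hemp).C q = (locTower hc hRa hν h0 b).C (Seg.relIdx hgen b q) := rfl

/-- `1 ≤ unitLen`. [cite: CossartJannsenSaito2020, Def. 6.38] -/
theorem one_le_unitLen (b : ℕ) : 1 ≤ unitLen hgen hBG b :=
  Seg.one_le_relLen hgen hBG b

/-! ### The setting of the unit tower -/

/-- **The initial stage of the unit tower is LOCAL at the initial point.** [cite: CossartJannsenSaito2020, p. 107] -/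
theorem isLocalAt_unitTower (b : ℕ) (hemp : HEmp hc hRa hν h0 b) :
    IsLocalAt ((unitTower hc hRa hν h0 hgen b hemp).X 0) (basePt hc hRa hν h0 b) :=
  (upTower hc hRa hν h0 b).isLocalAt_localize_zero (c b).pt

/-- **`KeySetting` for the unit tower** (the local ring of an excellent scheme is excellent; `dim ≤ N`). [cite: CossartJannsenSaito2020, p. 107] -/
theorem keySetting_unitTower (b : ℕ) (hemp : HEmp hc hRa hν h0 b) : KeySetting (unitTower hc hRa hν h0 hgen b hemp) N := by
  have h := (upTower hc hRa hν h0 b).keySetting_localize (c b).pt N (keySetting_upTower hc hRa hν h0 b)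
  exact ⟨h.1, h.2⟩

/-- **(F1) for the unit tower** from (F1) at `x_b ∈ X_b`. [cite: CossartJannsenSaito2020, Thm. 10.2, p. 107] -/
theorem charHypothesis_unitTower (b : ℕ) (hemp : HEmp hc hRa hν h0 b) (h : CharHypothesis (c b).W (c b).pt) :
    CharHypothesis ((unitTower hc hRa hν h0 hgen b hemp).X 0) (basePt hc hRa hν h0 b) :=
  (upTower hc hRa hν h0 b).charHypothesis_localize (c b).pt h

/-- **Isolation of the initial point in the Hilbert–Samuel locus of the (local) initial stage** from isolation of `x_b` in its `ν`-stratum,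
given upper semicontinuity of `H` along generizations at `x_b`. [cite: CossartJannsenSaito2020, Def. 13.3, Thm. 2.33 (1)] -/
theorem isIsolatedInHSMaxLocus_unitTower (b : ℕ) (hemp : HEmp hc hRa hν h0 b)
    (hsc : ∀ y : (c b).W, y ⤳ (c b).pt → Scheme.hsFun (c b).W N y ≤ Scheme.hsFun (c b).W N (c b).pt)
    (hU : ∃ U : Set (c b).W, IsOpen U ∧ (c b).pt ∈ U ∧ U ∩ Scheme.hsStratum (c b).W N (Scheme.hsFun (c b).W N (c b).pt) ⊆ {(c b).pt}) :
    @IsIsolatedInHSMaxLocus ((unitTower hc hRa hν h0 hgen b hemp).X 0) ((unitTower hc hRa hν h0 hgen b hemp).ln 0) N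
      (basePt hc hRa hν h0 b) :=
  isIsolatedInHSMaxLocus_localize_of_stratumIsolated (upTower hc hRa hν h0 b) (c b).pt N hsc hU

/-- **The centres of the unit tower are permissible** (053's (m3) transport of lead-1's permissibility of the canonical centres).
[cite: CossartJannsenSaito2020, Def. 3.1, Lemma 5.34 (3)] -/
theorem isPermissible_centreIdeal_unitTower (b : ℕ) (hemp : HEmp hc hRa hν h0 b) (q : ℕ) :
    IdealSheafData.IsPermissible ((unitTower hc hRa hν h0 hgen b hemp).centreIdeal q) :=
  (upTower hc hRa hν h0 b).isPermissible_centreIdeal_localize (c b).pt _ (isPermissible_centreIdeal_upTower hc hRa hν h0 b _)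

end Unit

end Summit.ResolutionOfSingularities.ResolutionOfSingularities.Theorems.SigmaMaxModificationsCorridor3.Moving.Seg

end
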